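import Literature.AnabelianGeometry.SemiGraphs.UniversalCoveringOver
import Literature.AnabelianGeometry.SemiGraphs.OrbitGraphOrbits
import Literature.AnabelianGeometry.SemiGraphs.TemperedCoveringsSubgraph
import Literature.AnabelianGeometry.SemiGraphs.FundamentalGroupImmersions
import HarnessLib

/-!
# The universal graph-covering over a covering commutes with restriction to a sub-semi-graph, up to a
# fibre-injective comparison map `𝒢_ℍ,{∞,S|ℍ} → (𝒢_{∞,S})|_ℍ` ([SemiAnbd] §3 p. 38; [IUTchI] §2 p. 44)

Mochizuki, *Semi-graphs of anabelioids*, Publ. RIMS **42** (2006), §3 p. 38 ("`𝒢_{∞,i} → 𝒢_i` for the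
covering of `𝒢_i` determined by the universal graph-covering of the underlying semi-graph `𝔾_i`"), §1
p. 15 (universal graph-coverings), Cor. 1.6 (i) p. 19 (immersions and fundamental groups)
[cite: MochizukiSemiAnbd2006, Prop 3.6 p.38]; Mochizuki, *Inter-universal Teichmüller theory I*, §2
p. 44 l. 39–44 ("natural … decomposition groups `Π^tp_ℍ ⊆ Π^tp_𝔾`", INCLUSIONS of topological groups)
[cite: Mochizuki2012, IUTchI §2 p.44].

abc-iut cell, layer L3, row «DECOMP-EMB» part (C) (seat abc-iut-L3-d1 gen 8): the GEOMETRIC CORE of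
the domination statement (DOM) «every tempered covering of `𝒢_ℍ` is (pointedly) dominated by a
fibre-injective sub-covering of the restriction to `ℍ` of a tempered covering of `𝒢`» (abc-iut-w4-d052's
displayed hypothesis `hdom`, which yields "the decomposition homomorphism `π₁^temp(𝒢_ℍ) → π₁^temp(𝒢)`
induces the topology", hence [IUTchI] Prop. 2.2 / Cor. 2.3 (v) for decomposition subgroups).  For an
object `S` of `B^cov(𝒢)`, a sub-semi-graph `ℍ` and the restricted covering `S|_ℍ := (covRestrict ℍ) S`:

* `CovObj.restrictOVertex` / `restrictOEdge` / `restrictOrbitGraphHom` — the morphism of underlying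
  semi-graphs `𝔾_{S|ℍ} → 𝔾_S` (an orbit of `Π_v` on `S_v`, `v ∈ ℍ`, is an orbit of `S`), injective on
  vertices and edges (`…_injective`) and an IMMERSION (`restrictOrbitGraphHom_isImmersion`);
* `CovObj.restrictPathMap_injective` — hence (abc-iut-L3-t1's Stallings normal forms,
  `IsImmersion.mapFundamentalGroup_injective`) the induced functor of fundamental groupoids is FAITHFUL:
  path classes of `𝔾_{S|ℍ}` with the same image in `𝔾_S` coincide;
* `CovObj.restrictUnivCoverHom` — the comparison morphism of `B^cov(𝒢_ℍ)`
  `Ψ : (S|_ℍ).univCoverOver [x₀] ⟶ (covRestrict ℍ)(S.univCoverOver [x₀])`,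
  `(V, x, p) ↦ (V, x, p)` (path classes pushed into `𝔾_S`), compatible with the gluings
  (`glueOverFun_restrictFibEMap`), sending base point to base point (`restrictUnivCoverHom_basePt`) and
  INJECTIVE ON EVERY FIBRE (`restrictUnivCoverHom_fV_injective`, `…_fE_injective`) by the faithfulness.

So the universal graph-covering of `𝒢_ℍ` over `S|_ℍ` is a fibre-injective sub-covering of the restriction
to `ℍ` of the universal graph-covering of `𝒢` over `S` — the object `C`, with `ι := Ψ`, of (DOM).  The
assembly of (DOM) is the sequel `TemperedDominationOfRestriction.lean`.  One `def` group (the maps);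
no instance, no notation, no new named fact; nothing here takes a side on [IUTchIII] Cor. 3.12.
-/

namespace Literature.AnabelianGeometry.SemiGraphs

namespace ProfiniteSemiGraph

open CategoryTheory

universe u

variable {𝒢 : ProfiniteSemiGraph.{u}} (H : 𝒢.graph.Subgraph) (S : CovObj 𝒢)

/-! ### `𝔾_{S|ℍ} → 𝔾_S`: orbits of the restriction are orbits -/

/-- A vertex-orbit of `S|_ℍ` (an orbit of `Π_v` on `S_v`, `v ∈ ℍ`) as a vertex-orbit of `S`.
[cite: MochizukiSemiAnbd2006, Def 3.5(i) p.37] -/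
def CovObj.restrictOVertex : ((𝒢.covRestrict H).obj S).OVertex → S.OVertex :=
  Quot.map (fun p => ⟨p.1.1, p.2⟩) (by
    rintro _ _ ⟨v, g, x⟩
    exact CovObj.VRel.mk (S := S) v.1 g x)

/-- An edge-orbit of `S|_ℍ` as an edge-orbit of `S`. [cite: MochizukiSemiAnbd2006, Def 3.5(i) p.37] -/
def CovObj.restrictOEdge : ((𝒢.covRestrict H).obj S).OEdge → S.OEdge :=
  Quot.map (fun p => ⟨p.1.1, p.2⟩) (by
    rintro _ _ ⟨e, g, y⟩
    exact CovObj.ERel.mk (S := S) e.1 g y)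

/-- `restrictOVertex` lies over the inclusion of vertices. [cite: MochizukiSemiAnbd2006, Def 3.5(i) p.37] -/
theorem CovObj.restrictOVertex_base (V : ((𝒢.covRestrict H).obj S).OVertex) :
    CovObj.OVertex.base S (CovObj.restrictOVertex H S V) =
      (CovObj.OVertex.base ((𝒢.covRestrict H).obj S) V).1 := by
  induction V using Quot.ind with
  | mk p => rfl

/-- `restrictOEdge` lies over the inclusion of edges. [cite: MochizukiSemiAnbd2006, Def 3.5(i) p.37] -/
theorem CovObj.restrictOEdge_base (E : ((𝒢.covRestrict H).obj S).OEdge) :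
    CovObj.OEdge.base S (CovObj.restrictOEdge H S E) =
      (CovObj.OEdge.base ((𝒢.covRestrict H).obj S) E).1 := by
  induction E using Quot.ind with
  | mk p => rfl

/-- `restrictOVertex` is injective (two points of `S_v` in one `Π_v`-orbit of `S` are in one orbit of
`S|_ℍ`). [cite: MochizukiSemiAnbd2006, Def 3.5(i) p.37] -/
theorem CovObj.restrictOVertex_injective : Function.Injective (CovObj.restrictOVertex H S) := by
  intro V₁ V₂ h
  induction V₁ using Quot.ind with
  | mk p₁ =>
  induction V₂ using Quot.ind with
  | mk p₂ =>
    obtain ⟨v₁, x₁⟩ := p₁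
    obtain ⟨v₂, x₂⟩ := p₂
    change (Quot.mk S.VRel ⟨v₁.1, x₁⟩ : S.OVertex) = Quot.mk S.VRel ⟨v₂.1, x₂⟩ at h
    have hv : v₁ = v₂ := Subtype.ext (congrArg (CovObj.OVertex.base S) h)
    subst hv
    obtain ⟨g, hg⟩ := S.exists_ρ_of_mk_eq_mk h
    rw [← hg]
    exact Quot.sound (CovObj.VRel.mk (S := (𝒢.covRestrict H).obj S) v₁ g x₁)

/-- `restrictOEdge` is injective. [cite: MochizukiSemiAnbd2006, Def 3.5(i) p.37] -/
theorem CovObj.restrictOEdge_injective : Function.Injective (CovObj.restrictOEdge H S) := by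
  intro E₁ E₂ h
  induction E₁ using Quot.ind with
  | mk p₁ =>
  induction E₂ using Quot.ind with
  | mk p₂ =>
    obtain ⟨e₁, y₁⟩ := p₁
    obtain ⟨e₂, y₂⟩ := p₂
    change (Quot.mk S.ERel ⟨e₁.1, y₁⟩ : S.OEdge) = Quot.mk S.ERel ⟨e₂.1, y₂⟩ at h
    have he : e₁ = e₂ := Subtype.ext (congrArg (CovObj.OEdge.base S) h)
    subst he
    obtain ⟨g, hg⟩ := S.exists_ρE_of_mk_eq_mk h
    rw [← hg]
    exact Quot.sound (CovObj.ERel.mk (S := (𝒢.covRestrict H).obj S) e₁ g y₁)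

/-- The gluings of `S|_ℍ` are those of `S`: `glueOpt` commutes with the orbit maps.
[cite: MochizukiSemiAnbd2006, Def 3.5(i) p.37] -/
theorem CovObj.glueOpt_restrictOEdge (b : H.toSemiGraph.Branch) (v : H.toSemiGraph.Vertex)
    (h : H.toSemiGraph.abuts b = some v) (E : ((𝒢.covRestrict H).obj S).OEdge) :
    S.glueOpt b.1 v.1 ((H.abuts_eq_some_iff b v).mp h) (CovObj.restrictOEdge H S E) =
      (((𝒢.covRestrict H).obj S).glueOpt b v h E).map (CovObj.restrictOVertex H S) := by
  induction E using Quot.ind with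
  | mk p =>
    obtain ⟨e, y⟩ := p
    by_cases he : e = H.toSemiGraph.edgeOf b
    · subst he
      change S.glueOpt b.1 v.1 _ (Quot.mk _ ⟨𝒢.graph.edgeOf b.1, y⟩) =
        (((𝒢.covRestrict H).obj S).glueOpt b v h
          (Quot.mk _ ⟨(𝒢.restrict H).graph.edgeOf b, y⟩)).map _
      rw [S.glueOpt_mk]
      erw [((𝒢.covRestrict H).obj S).glueOpt_mk b v h y]
      rfl
    · have he' : ¬ e.1 = 𝒢.graph.edgeOf b.1 := fun h1 => he (Subtype.ext h1)
      have h1 : S.glueOpt b.1 v.1 ((H.abuts_eq_some_iff b v).mp h) (Quot.mk _ ⟨e.1, y⟩) = none :=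
        dif_neg he'
      have h2 : ((𝒢.covRestrict H).obj S).glueOpt b v h (Quot.mk _ ⟨e, y⟩) = none := dif_neg he
      change S.glueOpt b.1 v.1 _ (Quot.mk _ ⟨e.1, y⟩) =
        (((𝒢.covRestrict H).obj S).glueOpt b v h (Quot.mk _ ⟨e, y⟩)).map _
      rw [h1, h2]
      rfl

/-- **The morphism of underlying semi-graphs `𝔾_{S|ℍ} → 𝔾_S`** (over the inclusion `ℍ → 𝔾`): the
underlying semi-graph of the restricted covering is the part of `𝔾_S` over `ℍ`.
[cite: MochizukiSemiAnbd2006, Def 3.5(i) p.37] -/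
noncomputable def CovObj.restrictOrbitGraphHom : ((𝒢.covRestrict H).obj S).orbitGraph ⟶ S.orbitGraph where
  vertexMap := CovObj.restrictOVertex H S
  edgeMap := CovObj.restrictOEdge H S
  branchMap := fun p => ⟨(p.1.1.1, CovObj.restrictOEdge H S p.1.2),
    (CovObj.restrictOEdge_base H S p.1.2).trans (congrArg Subtype.val p.2)⟩
  edgeOf_branchMap := fun _ => rfl
  branchMap_injOn := by
    rintro ⟨⟨b₁, E₁⟩, h₁⟩ ⟨⟨b₂, E₂⟩, h₂⟩ (hE : E₁ = E₂) hb
    subst hE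
    have hb' : b₁.1 = b₂.1 := congrArg (fun q : {p : 𝒢.graph.Branch × S.OEdge //
      CovObj.OEdge.base S p.2 = 𝒢.graph.edgeOf p.1} => q.1.1) hb
    have hb'' : b₁ = b₂ := Subtype.ext hb'
    subst hb''
    rfl
  abuts_branchMap := by
    rintro ⟨⟨b, E⟩, hE⟩ V hV
    rcases hab : H.toSemiGraph.abuts b with _ | v
    · rw [((𝒢.covRestrict H).obj S).orbitGraph_abuts_of_none b E hE hab] at hV
      exact absurd hV (by simp)
    · rw [((𝒢.covRestrict H).obj S).orbitGraph_abuts_of_abuts b E hE v hab] at hV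
      change S.orbitGraph.abuts ⟨(b.1, CovObj.restrictOEdge H S E), _⟩ =
        some (CovObj.restrictOVertex H S V)
      rw [S.orbitGraph_abuts_of_abuts b.1 _ _ v.1 ((H.abuts_eq_some_iff b v).mp hab),
        CovObj.glueOpt_restrictOEdge H S b v hab E, hV]
      rfl

/-- **`𝔾_{S|ℍ} → 𝔾_S` is an immersion** (injective on stars: it is injective on branches).
[cite: MochizukiSemiAnbd2006, §1 pp.13-14] -/
theorem CovObj.restrictOrbitGraphHom_isImmersion :
    SemiGraph.IsImmersion (CovObj.restrictOrbitGraphHom H S) := by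
  intro V b₁ b₂ h
  have h1 := congrArg Subtype.val h
  change (CovObj.restrictOrbitGraphHom H S).branchMap b₁.1 =
    (CovObj.restrictOrbitGraphHom H S).branchMap b₂.1 at h1
  obtain ⟨⟨⟨bb₁, E₁⟩, hE₁⟩, hb₁⟩ := b₁
  obtain ⟨⟨⟨bb₂, E₂⟩, hE₂⟩, hb₂⟩ := b₂
  have hb : bb₁.1 = bb₂.1 := congrArg (fun q : {p : 𝒢.graph.Branch × S.OEdge //
      CovObj.OEdge.base S p.2 = 𝒢.graph.edgeOf p.1} => q.1.1) h1
  have hE : CovObj.restrictOEdge H S E₁ = CovObj.restrictOEdge H S E₂ :=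
    congrArg (fun q : {p : 𝒢.graph.Branch × S.OEdge //
      CovObj.OEdge.base S p.2 = 𝒢.graph.edgeOf p.1} => q.1.2) h1
  have hb' : bb₁ = bb₂ := Subtype.ext hb
  have hE' : E₁ = E₂ := CovObj.restrictOEdge_injective H S hE
  subst hb'
  subst hE'
  rfl

/-! ### Faithfulness of `𝔾_{S|ℍ} → 𝔾_S` on fundamental groupoids -/

/-- **Path classes of `𝔾_{S|ℍ}` with the same image in `𝔾_S` coincide**: the functor of fundamental
groupoids induced by the immersion `𝔾_{S|ℍ} → 𝔾_S` is faithful (injectivity on the vertex groups,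
abc-iut-L3-t1's `IsImmersion.mapFundamentalGroup_injective`, transported along `p ↦ p ≫ q⁻¹`).
[cite: MochizukiSemiAnbd2006, Cor. 1.6(i) p.19] -/
theorem CovObj.restrictPathMap_injective (x y : ((𝒢.covRestrict H).obj S).orbitGraph.CatCarrier) :
    Function.Injective (fun p : ((𝒢.covRestrict H).obj S).orbitGraph.basept x ⟶
        ((𝒢.covRestrict H).obj S).orbitGraph.basept y =>
      (SemiGraph.Hom.mapFundamentalGroupoid (CovObj.restrictOrbitGraphHom H S)).map p) := by
  intro p q hpq
  change (SemiGraph.Hom.mapFundamentalGroupoid (CovObj.restrictOrbitGraphHom H S)).map p =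
    (SemiGraph.Hom.mapFundamentalGroupoid (CovObj.restrictOrbitGraphHom H S)).map q at hpq
  have h1 : (SemiGraph.Hom.mapFundamentalGroupoid (CovObj.restrictOrbitGraphHom H S)).map (p ≫ inv q) =
      𝟙 _ := by
    rw [Functor.map_comp, Functor.map_inv, hpq, IsIso.hom_inv_id]
  have h2 : SemiGraph.Hom.mapFundamentalGroup (CovObj.restrictOrbitGraphHom H S) x (p ≫ inv q) =
      SemiGraph.Hom.mapFundamentalGroup (CovObj.restrictOrbitGraphHom H S) x 1 := by
    rw [map_one]
    exact h1
  have h3 : p ≫ inv q = 𝟙 _ :=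
    (SemiGraph.IsImmersion.mapFundamentalGroup_injective
      (CovObj.restrictOrbitGraphHom_isImmersion H S) x) h2
  simpa using congrArg (· ≫ q) h3

/-! ### The comparison map `𝒢_ℍ,{∞,S|ℍ} → (𝒢_{∞,S})|_ℍ` -/

section Comparison

variable (h𝒢 : 𝒢.IsCountable) (hH : (𝒢.restrict H).IsCountable)
  {v₀ : H.toSemiGraph.Vertex} (x₀ : (S.SV v₀.1).obj.V)

/-- The image of a path class of `𝔾_{S|ℍ}` in `𝔾_S`. [cite: MochizukiSemiAnbd2006, Prop 3.6 p.38] -/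
noncomputable def CovObj.restrictPathMap {x y : ((𝒢.covRestrict H).obj S).orbitGraph.CatCarrier}
    (p : ((𝒢.covRestrict H).obj S).orbitGraph.basept x ⟶ ((𝒢.covRestrict H).obj S).orbitGraph.basept y) :
    S.orbitGraph.basept ((SemiGraph.Hom.catPrefunctor (CovObj.restrictOrbitGraphHom H S)).obj x) ⟶
      S.orbitGraph.basept ((SemiGraph.Hom.catPrefunctor (CovObj.restrictOrbitGraphHom H S)).obj y) :=
  (SemiGraph.Hom.mapFundamentalGroupoid (CovObj.restrictOrbitGraphHom H S)).map p

/-- `restrictPathMap` is compatible with composition. [cite: MochizukiSemiAnbd2006, Prop 3.6 p.38] -/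
theorem CovObj.restrictPathMap_comp {x y z : ((𝒢.covRestrict H).obj S).orbitGraph.CatCarrier}
    (p : ((𝒢.covRestrict H).obj S).orbitGraph.basept x ⟶ ((𝒢.covRestrict H).obj S).orbitGraph.basept y)
    (q : ((𝒢.covRestrict H).obj S).orbitGraph.basept y ⟶ ((𝒢.covRestrict H).obj S).orbitGraph.basept z) :
    CovObj.restrictPathMap H S (p ≫ q) = CovObj.restrictPathMap H S p ≫ CovObj.restrictPathMap H S q :=
  (SemiGraph.Hom.mapFundamentalGroupoid (CovObj.restrictOrbitGraphHom H S)).map_comp p q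

/-- `restrictPathMap` maps the arrow of a branch of `𝔾_{S|ℍ}` to the arrow of its image branch.
[cite: MochizukiSemiAnbd2006, Prop 3.6 p.38] -/
theorem CovObj.restrictPathMap_brArrow (bt : ((𝒢.covRestrict H).obj S).orbitGraph.Branch)
    (E : ((𝒢.covRestrict H).obj S).orbitGraph.Edge) (V : ((𝒢.covRestrict H).obj S).orbitGraph.Vertex)
    (he : ((𝒢.covRestrict H).obj S).orbitGraph.edgeOf bt = E)
    (hv : ((𝒢.covRestrict H).obj S).orbitGraph.abuts bt = some V) :
    CovObj.restrictPathMap H S (((𝒢.covRestrict H).obj S).orbitGraph.brArrow bt E V he hv) =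
      S.orbitGraph.brArrow ((CovObj.restrictOrbitGraphHom H S).branchMap bt) (CovObj.restrictOEdge H S E)
        (CovObj.restrictOVertex H S V)
        (by rw [(CovObj.restrictOrbitGraphHom H S).edgeOf_branchMap, he]; rfl)
        ((CovObj.restrictOrbitGraphHom H S).abuts_branchMap bt V hv) := by
  change 𝟙 _ ≫ _ = _
  exact Category.id_comp _

/-- The comparison map on the fibre over a vertex `v ∈ ℍ`: `(V, x, p) ↦ (V, x, p)` with the path class
pushed into `𝔾_S`. [cite: MochizukiSemiAnbd2006, Prop 3.6 p.38] -/
noncomputable def CovObj.restrictFibVMap (v : H.toSemiGraph.Vertex) :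
    ((𝒢.covRestrict H).obj S).FibV (Sum.inl (Quot.mk _ ⟨v₀, x₀⟩)) v →
      S.FibV (Sum.inl (Quot.mk _ ⟨v₀.1, x₀⟩)) v.1 :=
  fun t => ⟨⟨CovObj.restrictOVertex H S t.1.1,
      (CovObj.restrictOVertex_base H S t.1.1).trans (congrArg Subtype.val t.1.2)⟩,
    ⟨⟨t.2.1.1, congrArg (CovObj.restrictOVertex H S) t.2.1.2⟩, CovObj.restrictPathMap H S t.2.2⟩⟩

/-- The comparison map on the fibre over an edge `e ∈ ℍ`. [cite: MochizukiSemiAnbd2006, Prop 3.6 p.38] -/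
noncomputable def CovObj.restrictFibEMap (e : H.toSemiGraph.Edge) :
    ((𝒢.covRestrict H).obj S).FibE (Sum.inl (Quot.mk _ ⟨v₀, x₀⟩)) e →
      S.FibE (Sum.inl (Quot.mk _ ⟨v₀.1, x₀⟩)) e.1 :=
  fun t => ⟨⟨CovObj.restrictOEdge H S t.1.1,
      (CovObj.restrictOEdge_base H S t.1.1).trans (congrArg Subtype.val t.1.2)⟩,
    ⟨⟨t.2.1.1, congrArg (CovObj.restrictOEdge H S) t.2.1.2⟩, CovObj.restrictPathMap H S t.2.2⟩⟩

/-- **The comparison map is injective on the fibre over a vertex** (injectivity of the orbit map and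
FAITHFULNESS of `𝔾_{S|ℍ} → 𝔾_S` on path classes). [cite: MochizukiSemiAnbd2006, Cor. 1.6(i) p.19] -/
theorem CovObj.restrictFibVMap_injective (v : H.toSemiGraph.Vertex) :
    Function.Injective (CovObj.restrictFibVMap H S x₀ v) := by
  rintro ⟨⟨V₁, hV₁⟩, ⟨x₁, hx₁⟩, p₁⟩ ⟨⟨V₂, hV₂⟩, ⟨x₂, hx₂⟩, p₂⟩ h
  have hV : V₁ = V₂ := CovObj.restrictOVertex_injective H S
    (congrArg (fun s : S.FibV _ v.1 => s.1.1) h)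
  subst hV
  have hx : x₁ = x₂ := congrArg (fun s : S.FibV _ v.1 => s.2.1.1) h
  subst hx
  have hp' : CovObj.restrictPathMap H S p₁ = CovObj.restrictPathMap H S p₂ :=
    (Prod.ext_iff.mp (eq_of_heq (Sigma.mk.inj_iff.mp h).2)).2
  have hp : p₁ = p₂ := CovObj.restrictPathMap_injective H S _ _ hp'
  subst hp
  rfl

/-- The comparison map is injective on the fibre over an edge. [cite: MochizukiSemiAnbd2006, Cor. 1.6(i) p.19] -/
theorem CovObj.restrictFibEMap_injective (e : H.toSemiGraph.Edge) :
    Function.Injective (CovObj.restrictFibEMap H S x₀ e) := by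
  rintro ⟨⟨E₁, hE₁⟩, ⟨y₁, hy₁⟩, p₁⟩ ⟨⟨E₂, hE₂⟩, ⟨y₂, hy₂⟩, p₂⟩ h
  have hE : E₁ = E₂ := CovObj.restrictOEdge_injective H S
    (congrArg (fun s : S.FibE _ e.1 => s.1.1) h)
  subst hE
  have hy : y₁ = y₂ := congrArg (fun s : S.FibE _ e.1 => s.2.1.1) h
  subst hy
  have hp' : CovObj.restrictPathMap H S p₁ = CovObj.restrictPathMap H S p₂ :=
    (Prod.ext_iff.mp (eq_of_heq (Sigma.mk.inj_iff.mp h).2)).2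
  have hp : p₁ = p₂ := CovObj.restrictPathMap_injective H S _ _ hp'
  subst hp
  rfl

/-- **Compatibility of the comparison maps with the gluings** along a branch of `ℍ`: both composites
send `(E, y, q)` to `(glue E, glue y, q ≫ b̃)` read in `𝔾_S`. [cite: MochizukiSemiAnbd2006, Prop 3.6 p.38] -/
theorem CovObj.glueOverFun_restrictFibEMap (b : H.toSemiGraph.Branch) (v : H.toSemiGraph.Vertex)
    (h : H.toSemiGraph.abuts b = some v)
    (t : ((𝒢.covRestrict H).obj S).FibE (Sum.inl (Quot.mk _ ⟨v₀, x₀⟩)) (H.toSemiGraph.edgeOf b)) :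
    S.glueOverFun (Sum.inl (Quot.mk _ ⟨v₀.1, x₀⟩)) b.1 v.1 ((H.abuts_eq_some_iff b v).mp h)
        (CovObj.restrictFibEMap H S x₀ _ t) =
      CovObj.restrictFibVMap H S x₀ v (((𝒢.covRestrict H).obj S).glueOverFun _ b v h t) := by
  cases t with | mk E' yq =>
  cases yq with | mk yy q =>
  cases yy with | mk y hy =>
  cases E' with | mk E hE =>
  change Quot.mk _ _ = E at hy
  subst hy
  refine CovObj.FibV.ext S _ (Subtype.ext rfl) rfl ?_
  -- paths: `j_* q ≫ b̃_S` versus `j_* (q ≫ b̃_{S|ℍ}) = j_* q ≫ j_* b̃_{S|ℍ}`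
  change HEq (CovObj.restrictPathMap H S q ≫ S.brArrowOver b.1 v.1 ((H.abuts_eq_some_iff b v).mp h)
      ⟨CovObj.restrictOEdge H S (Quot.mk _ ⟨H.toSemiGraph.edgeOf b, y⟩),
        (CovObj.restrictOEdge_base H S _).trans (congrArg Subtype.val hE)⟩ y rfl)
    (CovObj.restrictPathMap H S (q ≫ ((𝒢.covRestrict H).obj S).brArrowOver b v h
      ⟨Quot.mk _ ⟨_, y⟩, hE⟩ y rfl))
  rw [CovObj.restrictPathMap_comp, CovObj.brArrowOver, CovObj.brArrowOver, CovObj.restrictPathMap_brArrow]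
  have aux : ∀ (V₁ V₂ : S.OVertex) (e : V₁ = V₂) (bt : S.orbitGraph.Branch)
      (he₁ : S.orbitGraph.edgeOf bt = CovObj.restrictOEdge H S (Quot.mk _ ⟨H.toSemiGraph.edgeOf b, y⟩))
      (h₁ : S.orbitGraph.abuts bt = some V₁) (h₂ : S.orbitGraph.abuts bt = some V₂),
      HEq (CovObj.restrictPathMap H S q ≫ S.orbitGraph.brArrow bt _ V₁ he₁ h₁)
        (CovObj.restrictPathMap H S q ≫ S.orbitGraph.brArrow bt _ V₂ he₁ h₂) := by
    intro V₁ V₂ e bt he₁ h₁ h₂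
    subst e
    rfl
  exact aux _ _ rfl _ rfl _ _

/-- **The comparison morphism `Ψ : 𝒢_ℍ,{∞,S|ℍ} ⟶ (𝒢_{∞,S})|_ℍ` of `B^cov(𝒢_ℍ)`** from the universal
graph-covering of `𝒢_ℍ` over the restricted covering `S|_ℍ` (based at the orbit of `x₀ ∈ S_{v₀}`,
`v₀ ∈ ℍ`) to the restriction to `ℍ` of the universal graph-covering of `𝒢` over `S` (based at the same
orbit). [cite: MochizukiSemiAnbd2006, Prop 3.6 p.38] -/
noncomputable def CovObj.restrictUnivCoverHom :
    ((𝒢.covRestrict H).obj S).univCoverOver (Sum.inl (Quot.mk _ ⟨v₀, x₀⟩)) hH ⟶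
      (𝒢.covRestrict H).obj (S.univCoverOver (Sum.inl (Quot.mk _ ⟨v₀.1, x₀⟩)) h𝒢) where
  fV v := ObjectProperty.homMk
    { hom := TypeCat.ofHom (CovObj.restrictFibVMap H S x₀ v)
      comm := fun g => by
        apply ConcreteCategory.hom_ext
        intro t
        exact CovObj.FibV.ext S _ rfl rfl HEq.rfl }
  fE e := ObjectProperty.homMk
    { hom := TypeCat.ofHom (CovObj.restrictFibEMap H S x₀ e)
      comm := fun g => by
        apply ConcreteCategory.hom_ext
        intro t
        exact CovObj.FibE.ext S _ rfl rfl HEq.rfl }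
  comm b v h := by
    apply ObjectProperty.hom_ext
    apply Action.Hom.ext
    apply ConcreteCategory.hom_ext
    intro t
    exact CovObj.glueOverFun_restrictFibEMap H S x₀ b v h t

/-- The comparison morphism on a point of a vertex fibre (definitional).
[cite: MochizukiSemiAnbd2006, Prop 3.6 p.38] -/
theorem CovObj.restrictUnivCoverHom_fV_apply (v : H.toSemiGraph.Vertex)
    (t : ((𝒢.covRestrict H).obj S).FibV (Sum.inl (Quot.mk _ ⟨v₀, x₀⟩)) v) :
    ((CovObj.restrictUnivCoverHom H S h𝒢 hH x₀).fV v).hom.hom t = CovObj.restrictFibVMap H S x₀ v t :=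
  rfl

/-- **`Ψ` is injective on every vertex fibre.** [cite: MochizukiSemiAnbd2006, Cor. 1.6(i) p.19] -/
theorem CovObj.restrictUnivCoverHom_fV_injective (v : H.toSemiGraph.Vertex) :
    Function.Injective ((CovObj.restrictUnivCoverHom H S h𝒢 hH x₀).fV v).hom.hom :=
  CovObj.restrictFibVMap_injective H S x₀ v

/-- **`Ψ` is injective on every edge fibre.** [cite: MochizukiSemiAnbd2006, Cor. 1.6(i) p.19] -/
theorem CovObj.restrictUnivCoverHom_fE_injective (e : H.toSemiGraph.Edge) :
    Function.Injective ((CovObj.restrictUnivCoverHom H S h𝒢 hH x₀).fE e).hom.hom :=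
  CovObj.restrictFibEMap_injective H S x₀ e

/-- **`Ψ` sends the base point `([x₀], x₀, 𝟙)` to the base point `([x₀], x₀, 𝟙)`.**
[cite: MochizukiSemiAnbd2006, Prop 3.6 p.38] -/
theorem CovObj.restrictUnivCoverHom_basePt :
    ((CovObj.restrictUnivCoverHom H S h𝒢 hH x₀).fV v₀).hom.hom
        ⟨⟨Quot.mk _ ⟨v₀, x₀⟩, rfl⟩, ⟨⟨x₀, rfl⟩, 𝟙 _⟩⟩ =
      (⟨⟨Quot.mk _ ⟨v₀.1, x₀⟩, rfl⟩, ⟨⟨x₀, rfl⟩, 𝟙 _⟩⟩ : S.FibV _ v₀.1) := by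
  refine CovObj.FibV.ext S _ rfl rfl (heq_of_eq ?_)
  exact (SemiGraph.Hom.mapFundamentalGroupoid (CovObj.restrictOrbitGraphHom H S)).map_id _

end Comparison

end ProfiniteSemiGraph

end Literature.AnabelianGeometry.SemiGraphs
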